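import Literature.AnabelianGeometry.EtaleTheta.TemperedFrobenioidCor38Sub
import Literature.AnabelianGeometry.EtaleTheta.TemperedFrobenioidToy
import Literature.AlgebraicGeometry.Frobenioids.NonPreservationOfUnitsCovariant
import HarnessLib

/-!
# [EtTh] Cor. 3.8, proof row `PreservesOTri` ("`Ψ` preserves the submonoids `O^▷(−)`") over the typed
# record `Cor38Hyp`: the bare universal closure is FALSE — [FrdI] Example 3.9 transported (kernel certificate)

S. Mochizuki, *The étale theta function and its Frobenioid-theoretic manifestations*, Publ. RIMS **45**
(2009) [MochizukiEtTh2009], proof of Cor. 3.8, PDF p. 81 l. 5–8: "By applying [Mzk17], Theorem 3.4, (iv),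
in the case of assertion (i), and … Corollary 4.11, (ii), in the case of assertion (ii), it follows that
`Ψ` preserves the submonoids '`O^▷(−)`'" [cite: MochizukiEtTh2009, Cor 3.8 p.81].  S. Mochizuki, *The geometry
of Frobenioids I*, Kyushu J. Math. **62** (2008) [MochizukiFrdI2008], Example 3.9 "Non-preservation of units"
(kurims p. 72; journal p. 355): over the one-object base `D` with `End = G = U ⋊ N` (`U = ℚ`, `N = (ℕ_{≥1})^gp`,
`n` acting on `U` by `n⁻¹`) and the monoid `Φ(•) = V × W = ℚ × ℤ_{≥0}` on which `g ↦ n` rescales `V`, "the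
assignment `(u, v, w, n, m) ↦ (v, u, w, n⁻¹·m⁻¹, m)` … determines an automorphism of the monoid `M`, hence
a self-equivalence of `C`, which clearly fails to preserve '`O^×(−)`', '`O^▷(−)`'" [cite: MochizukiFrdI2008,
Ex. 3.9 p.72] — the phenomenon that the Frobenius-slimness / Div-slimness hypotheses of [FrdI] Thm. 3.4 (iv) /
Cor. 4.11 (ii) (hence of [EtTh] Cor. 3.8 (i)/(ii)) exclude ([FrdI] Rem. 4.11.2).

abc-iut cell, block F (FACT-LIST fact-proving wave), seat abc-iut-f-023 (gen 4), row **F-2812**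
`Cor38Hyp.PreservesOTri` of abc-iut-w5-d124's statements-first sub-DAG `TemperedFrobenioidCor38Sub.lean` (class
`preparatory`, kernel_closedness `parametrised`: the parameter `h : Cor38Hyp C₁ C₂` is an ARBITRARY equivalence
of the underlying categories + "`D_i` of FSMFF-type" + "`Φ_i` non-dilating", over FREE [FrdI] vocabularies; no
slimness of `D_i` is part of the record).  INSTANCE forms (the Cor. 3.8 knits consume them BY NAME; not
restated): abc-iut-f-001's `Cor38Hyp.preservesOTri_treeCatVocab_of_isFrobeniusSlim` / `…_of_baseSquares`
(p430635), `preservesOTri_of_thm34iv` / `preservesOTri_of_baseSquare` (the sub-DAG).  THIS file decides the bare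
universal closure (cell rule R5): **FALSE**, by the tree's Example 3.9 (`Literature/AlgebraicGeometry/Frobenioids/
NonPreservationOfUnits*.lean`, seat abc-iut-L1: `RatSemidirect.G`, `Ex39.Φ'` = the inverse-convention action
under which the printed law of `M` holds, `Ex39.endLaw_covariant`) dressed as a typed tempered Frobenioid:

* §1 `OTriTwist.realified` / `OTriTwist.C`: Def. 3.3 (iii)/3.6 (i)/3.6 (ii) data over `D₀ = D = SingleObj G`
  with `Φ₀ = Φ₀^ℝ = Φ = Ex39.Φ'` (`ℚ × ℤ_{≥0}`, `g ↦ (n⁻¹, 1)`), `B₀ = B₀^Λ = Φ^gp`, `Div = id` (every class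
  principal), `ℝ·Φ₀^cnst = F₀^Λ := Ker(V-coordinate)` (root-closed, `G`-stable), so that `Φ^{bs-fld} = 0 × ℤ_{≥0}`
  IS `ℤ`-monoprime and Def. 3.6 (ii)(b) holds (the constant `(0,1)` has divisor `(0,1)`); every typed field is met;
* §2 the category of `C` is the model Frobenioid; its arrows `(m, g = (u,n), z = (v,w), b)` have the unit
  component DETERMINED by the relation (`hom_ext₃`), and **`swap : (m, (u,n), (v,w)) ↦ (m, (n·v, n⁻¹m⁻¹), (u·n·m, w))`**
  on every hom-set is an involutive endofunctor (`swap_swap`), hence an autoequivalence `swapEquiv`, and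
  `OTriTwist.hyp : Cor38Hyp C C` (base of FSM-, hence FSMFF-type: `Ex39.isOfFSMFFType_D`; "non-dilating" reads
  `True` in the trivial vocabulary);
* §3 **F-2812 FAILS at `hyp`**: the base-identity linear endomorphism `α₀ = (1, 1_G, (1,0))` of the
  Frobenius-trivial object lies in `O^▷` and `swap α₀` has base `(1, 1) ≠ 1_G` (`not_preservesOTri`); the
  universal closure (universe level `0`) is FALSE (`not_forall_preservesOTri`).  At the same record
  `PreservesLinear` and `PreservesPreSteps` HOLD (`preservesLinear_hyp`, `preservesPreSteps_hyp`): the datum keeps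
  `deg_Fr` — it does not bear on the closures of F-2809 / F-2815 (seats abc-iut-L1-t13 / abc-iut-f-136).

Reading (R5): F-2812 is admissible ONLY as its instance forms.  The gap is a SCHEMA gap of OUR typed interface
(`Cor38Hyp` carries neither the Frobenius-slimness nor the Div-slimness of `D_i` that print assumes in Cor. 3.8
(i)/(ii)) and is Mochizuki's own example of why those hypotheses are needed; nothing of [EtTh] Cor. 3.8 or
[FrdI] Thm. 3.4 / Cor. 4.11 as printed is contradicted.  HONEST FRAMING: refereed pre-IUT material; nothing here
bears on the disputed [IUTchIII] Cor. 3.12; no side taken; typed ≠ proved.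
-/

noncomputable section

namespace Literature.AnabelianGeometry.EtaleTheta

open CategoryTheory Opposite Literature.AlgebraicGeometry.Frobenioids

namespace OTriTwist

open RatSemidirect Ex39

/-! ### §1  Example 3.9 as typed Def. 3.3 (iii) / 3.6 (i) / 3.6 (ii) data -/

/-- `Φ(•) = V × W = ℚ × ℤ_{≥0}`, written multiplicatively. [cite: MochizukiFrdI2008, Ex. 3.9 p.72] -/
abbrev VW : Type := Multiplicative (ℚ × ℕ)

/-- The `V`-coordinate `(v, w) ↦ v` of `ℚ × ℤ_{≥0}`. [cite: MochizukiFrdI2008, Ex. 3.9 p.72] -/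
def χV : VW →* Multiplicative ℚ := (AddMonoidHom.fst ℚ ℕ).toMultiplicative

/-- Values of `χV`. [cite: MochizukiFrdI2008, Ex. 3.9 p.72] -/
@[simp] theorem χV_apply (z : VW) : χV z = Multiplicative.ofAdd (Multiplicative.toAdd z).1 := rfl

/-- The `V`-coordinate on the groupification `(ℚ × ℤ_{≥0})^gp → ℚ`. [cite: MochizukiFrdI2008, Ex. 3.9 p.72] -/
def ψV : Algebra.GrothendieckGroup VW →* Multiplicative ℚ := Algebra.GrothendieckGroup.lift χV

/-- `ψV` extends `χV`. [cite: MochizukiFrdI2008, Ex. 3.9 p.72] -/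
@[simp] theorem ψV_of (z : VW) : ψV (Algebra.GrothendieckGroup.of z) = χV z := by
  have h := Algebra.GrothendieckGroup.lift.symm_apply_apply χV
  rw [Algebra.GrothendieckGroup.lift_symm_apply] at h
  exact DFunLike.congr_fun h z

/-- Rescaling `ℚ` by a constant, multiplicatively. [folklore] -/
def scaleQ (c : ℚ) : Multiplicative ℚ →* Multiplicative ℚ := (AddMonoidHom.mulLeft c).toMultiplicative

/-- The `V`-coordinate of a pull-back `Φ(g)` is the `V`-coordinate rescaled by `n⁻¹`.
[cite: MochizukiFrdI2008, Ex. 3.9 p.72] -/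
theorem ψV_comp_gpMap_act' (g : G) :
    ψV.comp (gpMap (act' g)) = (scaleQ ((g.n : ℚ)⁻¹)).comp ψV :=
  MonGp.hom_ext fun z => by
    change ψV (gpMap (act' g) (Algebra.GrothendieckGroup.of z)) =
      scaleQ ((g.n : ℚ)⁻¹) (ψV (Algebra.GrothendieckGroup.of z))
    rw [gpMap_of, ψV_of, ψV_of, χV_apply, χV_apply, toAdd_act']
    rfl

/-- `Ker(ψV)` is stable under the pull-backs `Φ(g)^gp`. [cite: MochizukiFrdI2008, Ex. 3.9 p.72] -/
theorem mem_ker_ψV_gpMap {g : G} {x : Algebra.GrothendieckGroup VW} (hx : x ∈ ψV.ker) :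
    gpMap (act' g) x ∈ ψV.ker := by
  rw [MonoidHom.mem_ker] at hx ⊢
  have h := DFunLike.congr_fun (ψV_comp_gpMap_act' g) x
  rw [MonoidHom.comp_apply, MonoidHom.comp_apply, hx, map_one] at h
  exact h

/-- Def. 3.3 (iii) data: `Φ₀ := Φ' = ℚ × ℤ_{≥0}` with `g ↦ (n⁻¹, 1)`, `B₀ := Φ₀^gp`, `div₀ = id`, `F₀ = 1`, nothing
cuspidal, over `D₀ = SingleObj G`. [cite: MochizukiEtTh2009, Def 3.3 p.73] -/
def divisorMonoids : DivisorMonoids.{0, 0, 0} D where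
  Φ₀ := Φ'
  B₀ := monoidGp Φ'
  isUnit_B₀ _ b := by
    change IsUnit (M := Algebra.GrothendieckGroup VW) b
    exact Group.isUnit _
  div₀ _ := MonoidHom.id _
  div₀_natural _ _ := rfl
  F₀ _ := ⊥
  F₀_map _ _ hb := by
    rw [Submonoid.mem_bot] at hb ⊢
    rw [hb, map_one]
  ncsp₀ _ := ⊤
  csp₀ _ := ⊥
  ncsp₀_map _ _ _ := trivial
  csp₀_map _ x hx := by
    rw [Submonoid.mem_bot] at hx ⊢
    rw [hx, map_one]
  existsUnique_ncsp_csp _ x := by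
    refine ⟨(⟨x, trivial⟩, ⟨1, Submonoid.mem_bot.mpr rfl⟩), mul_one x, ?_⟩
    rintro ⟨a, c⟩ h
    have hc : c.1 = 1 := Submonoid.mem_bot.mp c.2
    have ha : a.1 = x := by
      have h' : a.1 * c.1 = x := h
      rwa [hc, mul_one] at h'
    exact Prod.ext (Subtype.ext ha) (Subtype.ext hc)

/-- Def. 3.6 (i) data (`Λ = ℤ`, `Φ₀^ℝ = Φ₀`, `B₀^Λ = Φ₀^gp`, `Div = id`) with `ℝ·Φ₀^cnst := Ker(ψV) = {(v,w)^gp | v = 0}`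
(a root-closed, `G`-stable subgroup) and `F₀^Λ :=` the same subgroup. [cite: MochizukiEtTh2009, Def 3.6 p.76] -/
def realified : RealifiedDivisorMonoids (D₀ := D) Toy.monoidVocab where
  toDivisorMonoids := divisorMonoids
  Λ := MonoidType.Z
  ΦR := Φ'
  toR _ := MonoidHom.id _
  toR_natural _ _ := rfl
  isRealification _ := trivial
  BΛ := monoidGp Φ'
  isUnit_BΛ _ b := by
    change IsUnit (M := Algebra.GrothendieckGroup VW) b
    exact Group.isUnit _
  divΛ _ := MonoidHom.id _
  divΛ_natural _ _ := rfl
  FΛ _ := (ψV).ker.toSubmonoid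
  FΛ_map f _ hb := mem_ker_ψV_gpMap (g := show G from f.unop) hb
  cnstR _ := (ψV).ker
  cnstR_map f _ hx := mem_ker_ψV_gpMap (g := show G from f.unop) hx
  divΛ_mem_cnstR _ _ hb := hb
  cnstR_root _ g n hg := by
    have hg' : ψV g ^ (n : ℕ) = 1 := by rw [← map_pow]; exact hg
    have h : (n : ℕ) • Multiplicative.toAdd (ψV g) = 0 := by
      have := congrArg Multiplicative.toAdd hg'
      rwa [toAdd_pow, toAdd_one] at this
    show ψV g = 1
    rcases smul_eq_zero.mp h with h | h
    · exact absurd h n.ne_zero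
    · exact congrArg Multiplicative.ofAdd h
  cnst_le_cnstR _ b hb := by
    have hb' : b = 1 := Submonoid.mem_bot.mp hb
    subst hb'
    show ψV (gpMap (MonoidHom.id VW) (MonoidHom.id _ 1)) = 1
    rw [map_one, map_one, map_one]
  ncspR _ := ⊤
  cspR _ := ⊥
  toR_ncsp _ _ _ := trivial
  toR_csp _ _ hx := hx

/-- The trivial [FrdI] category vocabulary on `D = SingleObj G`. [cite: MochizukiEtTh2009, Def 3.6 p.77] -/
def catVocab : FrdICatStub.{0, 0, 0} D where
  IsDivisorialOn _ := True
  IsRational _ := True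
  IsStrictlyRational _ := True

/-- `Φ^{bs-fld} = {(v, w) | v = 0} = 0 × ℤ_{≥0} ≅ ℤ_{≥0}`: the isomorphism `(0, w) ↦ w`.
[cite: MochizukiEtTh2009, Def 3.6 p.77] -/
def bsFldEquiv :
    ↥((⊤ : Submonoid VW) ⊓ ((ψV).ker).toSubmonoid.comap Algebra.GrothendieckGroup.of) ≃* Multiplicative ℕ where
  toFun z := Multiplicative.ofAdd (Multiplicative.toAdd z.1).2
  invFun k := ⟨Multiplicative.ofAdd (0, Multiplicative.toAdd k), Submonoid.mem_top _, by
    change Algebra.GrothendieckGroup.of (Multiplicative.ofAdd ((0 : ℚ), Multiplicative.toAdd k) : VW) ∈ (ψV).ker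
    rw [MonoidHom.mem_ker, ψV_of, χV_apply]
    rfl⟩
  left_inv z := by
    obtain ⟨z, -, hz⟩ := z
    apply Subtype.ext
    change Multiplicative.ofAdd ((0 : ℚ), (Multiplicative.toAdd z).2) = z
    have hz' : ψV (Algebra.GrothendieckGroup.of z) = 1 := hz
    rw [ψV_of, χV_apply] at hz'
    have h1 : (Multiplicative.toAdd z).1 = 0 := Multiplicative.ofAdd.injective hz'
    exact Multiplicative.toAdd.injective (Prod.ext h1.symm rfl)
  right_inv k := by simp
  map_mul' z z' := by
    change Multiplicative.ofAdd (Multiplicative.toAdd (z.1 * z'.1)).2 = _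
    rw [toAdd_mul, Prod.snd_add, ofAdd_add]

/-- **The typed tempered-Frobenioid interface is satisfied by Example 3.9's data**: `D = D₀ = SingleObj G`
(connected, a groupoid hence totally epimorphic), `Φ = Φ^{ℝ-log} = ℚ × ℤ_{≥0}` (group-saturated), `Φ^{bs-fld} =
0 × ℤ_{≥0}` monoprime (REAL `IsMonoprime`), and Def. 3.6 (ii)(b): the constant of divisor `(0,1) ≠ 0`.
[cite: MochizukiEtTh2009, Def 3.6 p.77] -/
def C : TemperedFrobenioid realified D catVocab where
  isConnected := zigzag_isConnected fun _ _ => Relation.ReflTransGen.refl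
  isTotallyEpimorphic := ⟨fun _ => inferInstance⟩
  base := 𝟭 D
  Φ := ⟨fun _ => ⊤, fun _ _ _ => trivial⟩
  isGroupSaturated A := (isGroupSaturated_iff' _).2 fun _ _ _ _ _ _ => trivial
  isPerfFactorial _ := trivial
  isDivisorialOn := trivial
  isMonoprime_bsFld _ := IsMonoprime.ofZ ⟨⟨bsFldEquiv⟩⟩
  exists_FΛ_div_ne _ := ⟨Algebra.GrothendieckGroup.of (Multiplicative.ofAdd ((0 : ℚ), (1 : ℕ))), by
      change Algebra.GrothendieckGroup.of (Multiplicative.ofAdd ((0 : ℚ), (1 : ℕ)) : VW) ∈ (ψV).ker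
      rw [MonoidHom.mem_ker, ψV_of, χV_apply]
      rfl,
    Multiplicative.ofAdd ((0 : ℚ), (1 : ℕ)), trivial, 1, trivial,
    ne_of_apply_ne (fun z : VW => (Multiplicative.toAdd z).2) (show (1 : ℕ) ≠ 0 from one_ne_zero),
    by rw [map_one, div_one]; rfl⟩

/-! ### §2  The category of `C` and the swap autoequivalence -/

variable {X Y Z : C.category}

/-- Coordinates of an arrow of `C`: the base component as an element of `G = U ⋊ N`.
[cite: MochizukiFrdI2008, Thm. 5.2 (i) p.100] -/
def gOf (φ : X ⟶ Y) : G := ModelFrobenioid.baseMap φ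

/-- Coordinates of an arrow of `C`: the zero divisor as an element of `Φ(•) = V × W` (multiplicative).
[cite: MochizukiFrdI2008, Thm. 5.2 (i) p.100] -/
def divVW (φ : X ⟶ Y) : VW := (ModelFrobenioid.div φ).1

/-- Coordinates of an arrow of `C`: the zero divisor `(v, w) ∈ ℚ × ℤ_{≥0}`. [cite: MochizukiFrdI2008, Thm. 5.2 (i) p.100] -/
def zOf (φ : X ⟶ Y) : ℚ × ℕ := Multiplicative.toAdd (divVW φ)

/-- `Base(id) = 1_G`. [cite: MochizukiFrdI2008, Thm. 5.2 (i) p.100] -/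
theorem gOf_id (X : C.category) : gOf (𝟙 X) = 1 := rfl

/-- `Div(id) = 0`. [cite: MochizukiFrdI2008, Thm. 5.2 (i) p.100] -/
theorem zOf_id (X : C.category) : zOf (𝟙 X) = 0 := rfl

/-- `Base` of a composite, in `G` (`SingleObj`: composition is multiplication in the opposite order).
[cite: MochizukiFrdI2008, Thm. 5.2 (i) p.100] -/
theorem gOf_comp (φ : X ⟶ Y) (ψ : Y ⟶ Z) : gOf (φ ≫ ψ) = gOf ψ * gOf φ := rfl

/-- `Div` of a composite, in coordinates: `(n_φ⁻¹·v_ψ + m_ψ·v_φ, w_ψ + m_ψ·w_φ)` (Def. 1.1 (iii) with the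
inverse-convention pull-back `Φ(g) = (n⁻¹, 1)`). [cite: MochizukiFrdI2008, Thm. 5.2 (i) p.100] -/
theorem zOf_comp (φ : X ⟶ Y) (ψ : Y ⟶ Z) :
    zOf (φ ≫ ψ) = (((gOf φ).n : ℚ)⁻¹ * (zOf ψ).1 + ((ModelFrobenioid.degFr ψ : ℕ) : ℚ) * (zOf φ).1,
      (zOf ψ).2 + (ModelFrobenioid.degFr ψ : ℕ) * (zOf φ).2) := by
  change Multiplicative.toAdd (act' (gOf φ) (divVW ψ) * divVW φ ^ (ModelFrobenioid.degFr ψ : ℕ)) = _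
  rw [toAdd_mul, toAdd_pow, toAdd_act']
  ext <;> simp [zOf, nsmul_eq_mul]

/-- The relation (d) of Thm. 5.2 (i) DETERMINES the unit component `b ∈ B(A) ≅ Φ^gp(A)` of an arrow of `C` (here
`Div_B = id`): `Div_B(b) = Φ(Base φ)(β)⁻¹ · α^{deg} · Div(φ)`. [cite: MochizukiFrdI2008, Thm. 5.2 (i) p.100] -/
theorem unit_snd_eq (φ : X ⟶ Y) :
    ((ModelFrobenioid.unit φ).1).2 =
      (pullGp C.divisorMonoid (ModelFrobenioid.baseMap φ) Y.cls)⁻¹ *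
        (X.cls ^ (ModelFrobenioid.degFr φ : ℕ) * Algebra.GrothendieckGroup.of (ModelFrobenioid.div φ)) :=
  eq_inv_mul_of_mul_eq (ModelFrobenioid.rel φ).symm

/-- **Arrows of `C` are determined by `(deg_Fr, Base, Div)`** (the unit component is solved from the relation:
`B = Φ^gp`, `Div_B = id`). [cite: MochizukiFrdI2008, Thm. 5.2 (i) p.100] -/
theorem hom_ext₃ {φ ψ : X ⟶ Y} (h₁ : ModelFrobenioid.degFr φ = ModelFrobenioid.degFr ψ) (h₂ : gOf φ = gOf ψ)
    (h₃ : zOf φ = zOf ψ) : φ = ψ := by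
  have h₂' : ModelFrobenioid.baseMap φ = ModelFrobenioid.baseMap ψ := h₂
  have h₃' : ModelFrobenioid.div φ = ModelFrobenioid.div ψ := Subtype.ext (Multiplicative.toAdd.injective h₃)
  apply ModelFrobenioid.hom_ext h₁ h₂' h₃'
  have h4 : ((ModelFrobenioid.unit φ).1).2 = ((ModelFrobenioid.unit ψ).1).2 := by
    rw [unit_snd_eq, unit_snd_eq, h₁, h₂', h₃']
  refine Subtype.ext (Prod.ext ?_ h4)
  exact ((ModelFrobenioid.unit φ).2).trans ((congrArg (C.ΦgpToRlog _) h4).trans (ModelFrobenioid.unit ψ).2.symm)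

/-- The unit component solved from the relation: for data `(m, g, z)` between objects `(•, α)`, `(•, β)`, the element
`Φ(g)(β)⁻¹ · α^m · z ∈ Φ^gp = B`. [cite: MochizukiFrdI2008, Thm. 5.2 (i) p.100] -/
def solveUnit (X Y : C.category) (m : ℕ+) (g : X.base ⟶ Y.base) (z : C.divisorMonoid.obj (op X.base)) :
    Algebra.GrothendieckGroup (C.divisorMonoid.obj (op X.base)) :=
  (pullGp C.divisorMonoid g Y.cls)⁻¹ * (X.cls ^ (m : ℕ) * Algebra.GrothendieckGroup.of z)

/-- The arrow of `C` with prescribed `(deg_Fr, Base, Div)` (unit component solved from the relation).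
[cite: MochizukiFrdI2008, Thm. 5.2 (i) p.100] -/
def mkHom (X Y : C.category) (m : ℕ+) (g : X.base ⟶ Y.base) (z : C.divisorMonoid.obj (op X.base)) : X ⟶ Y where
  degFr := m
  base := g
  div := z
  unit := ⟨(C.ΦgpToRlog _ (solveUnit X Y m g z), solveUnit X Y m g z), rfl⟩
  rel := by
    change X.cls ^ (m : ℕ) * Algebra.GrothendieckGroup.of z = pullGp C.divisorMonoid g Y.cls * solveUnit X Y m g z
    rw [solveUnit, mul_inv_cancel_left]

/-- The swapped base `(n·v, n⁻¹·m⁻¹) ∈ G` of an arrow `(m, (u,n), (v,w))`. [cite: MochizukiFrdI2008, Ex. 3.9 p.72] -/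
def swapBase (φ : X ⟶ Y) : G :=
  ⟨((gOf φ).n : ℚ) * (zOf φ).1, (gOf φ).n⁻¹ * (natPos (ModelFrobenioid.degFr φ))⁻¹⟩

/-- Components of the swapped base. [cite: MochizukiFrdI2008, Ex. 3.9 p.72] -/
@[simp] theorem swapBase_u (φ : X ⟶ Y) : (swapBase φ).u = ((gOf φ).n : ℚ) * (zOf φ).1 := rfl

/-- Components of the swapped base. [cite: MochizukiFrdI2008, Ex. 3.9 p.72] -/
@[simp] theorem swapBase_n (φ : X ⟶ Y) :
    (swapBase φ).n = (gOf φ).n⁻¹ * (natPos (ModelFrobenioid.degFr φ))⁻¹ := rfl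

/-- The swapped divisor `(u·n·m, w) ∈ ℚ × ℤ_{≥0}` of an arrow `(m, (u,n), (v,w))`. [cite: MochizukiFrdI2008, Ex. 3.9 p.72] -/
def swapDiv (φ : X ⟶ Y) : C.divisorMonoid.obj (op X.base) :=
  ⟨Multiplicative.ofAdd ((gOf φ).u * ((gOf φ).n : ℚ) * ((ModelFrobenioid.degFr φ : ℕ) : ℚ), (zOf φ).2), trivial⟩

/-- **The swap** `(m, (u,n), (v,w)) ↦ (m, (n·v, n⁻¹m⁻¹), (u·n·m, w))` of [FrdI] Example 3.9 on one arrow of `C`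
(unit component solved from the relation). [cite: MochizukiFrdI2008, Ex. 3.9 p.72] -/
def swapMap (φ : X ⟶ Y) : X ⟶ Y := mkHom X Y (ModelFrobenioid.degFr φ) (swapBase φ) (swapDiv φ)

/-- Frobenius degrees are untouched by the swap. [cite: MochizukiFrdI2008, Ex. 3.9 p.72] -/
@[simp] theorem degFr_swapMap (φ : X ⟶ Y) : ModelFrobenioid.degFr (swapMap φ) = ModelFrobenioid.degFr φ := rfl

/-- The base of a swapped arrow. [cite: MochizukiFrdI2008, Ex. 3.9 p.72] -/
@[simp] theorem gOf_swapMap (φ : X ⟶ Y) : gOf (swapMap φ) = swapBase φ := rfl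

/-- The divisor of a swapped arrow. [cite: MochizukiFrdI2008, Ex. 3.9 p.72] -/
@[simp] theorem zOf_swapMap (φ : X ⟶ Y) :
    zOf (swapMap φ) = ((gOf φ).u * ((gOf φ).n : ℚ) * ((ModelFrobenioid.degFr φ : ℕ) : ℚ), (zOf φ).2) := rfl

/-- The swap fixes identities. [cite: MochizukiFrdI2008, Ex. 3.9 p.72] -/
theorem swapMap_id (X : C.category) : swapMap (𝟙 X) = 𝟙 X := by
  refine hom_ext₃ rfl (G.ext ?_ ?_) ?_
  · rw [gOf_swapMap, swapBase_u, gOf_id, zOf_id]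
    simp
  · rw [gOf_swapMap, swapBase_n, gOf_id, ModelFrobenioid.degFr_id, G.one_n, map_one, inv_one, mul_one]
  · rw [zOf_swapMap, zOf_id, gOf_id, ModelFrobenioid.degFr_id]
    simp

/-- **The swap is multiplicative** ("determines an automorphism of the monoid `M`", p. 72; here on all hom-sets:
`swap(ψ ∘ φ) = swap(ψ) ∘ swap(φ)`). [cite: MochizukiFrdI2008, Ex. 3.9 p.72] -/
theorem swapMap_comp (φ : X ⟶ Y) (ψ : Y ⟶ Z) : swapMap (φ ≫ ψ) = swapMap φ ≫ swapMap ψ := by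
  have hφ : ((gOf φ).n : ℚ) ≠ 0 := ne_of_gt (gOf φ).n.2
  have hψ : ((gOf ψ).n : ℚ) ≠ 0 := ne_of_gt (gOf ψ).n.2
  have hm : (((ModelFrobenioid.degFr φ : ℕ+) : ℕ) : ℚ) ≠ 0 := by exact_mod_cast (ModelFrobenioid.degFr φ).ne_zero
  refine hom_ext₃ rfl (G.ext ?_ ?_) ?_
  · rw [gOf_comp, G.mul_u]
    simp only [gOf_swapMap, swapBase_u, swapBase_n, gOf_comp, zOf_comp, G.mul_n, Positive.val_mul,
      Positive.coe_inv, natPos_val]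
    field_simp
  · rw [gOf_comp, G.mul_n]
    simp only [gOf_swapMap, swapBase_n, gOf_comp, ModelFrobenioid.degFr_comp, G.mul_n, map_mul, mul_inv]
    rw [mul_mul_mul_comm]
  · rw [zOf_comp]
    simp only [zOf_swapMap, gOf_swapMap, degFr_swapMap, swapBase_n, gOf_comp, zOf_comp, ModelFrobenioid.degFr_comp,
      G.mul_u, G.mul_n, Positive.val_mul, Positive.coe_inv, natPos_val, PNat.mul_coe, Nat.cast_mul, Prod.mk.injEq]
    refine ⟨?_, trivial⟩
    field_simp

/-- **The swap as an endofunctor** of the category of `C` (identity on objects). [cite: MochizukiFrdI2008, Ex. 3.9 p.72] -/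
def swap : C.category ⥤ C.category where
  obj X := X
  map φ := swapMap φ
  map_id X := swapMap_id X
  map_comp φ ψ := swapMap_comp φ ψ

/-- **The swap is an involution** ("a routine verification", p. 72): `(u,v,w,n,m) ↦ (v,u,w,n⁻¹m⁻¹,m)` twice is the
identity. [cite: MochizukiFrdI2008, Ex. 3.9 p.72] -/
theorem swapMap_swapMap (φ : X ⟶ Y) : swapMap (swapMap φ) = φ := by
  have hφ : ((gOf φ).n : ℚ) ≠ 0 := ne_of_gt (gOf φ).n.2
  have hm : (((ModelFrobenioid.degFr φ : ℕ+) : ℕ) : ℚ) ≠ 0 := by exact_mod_cast (ModelFrobenioid.degFr φ).ne_zero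
  refine hom_ext₃ rfl (G.ext ?_ ?_) ?_
  · simp only [gOf_swapMap, swapBase_u, swapBase_n, zOf_swapMap, Positive.val_mul, Positive.coe_inv, natPos_val]
    field_simp
  · simp only [gOf_swapMap, swapBase_n, degFr_swapMap, mul_inv, inv_inv]
    rw [mul_inv_cancel_right]
  · rw [zOf_swapMap, gOf_swapMap, swapBase_u, swapBase_n, degFr_swapMap, zOf_swapMap]
    ext
    · simp only [Positive.val_mul, Positive.coe_inv, natPos_val]
      field_simp
    · rfl

/-- `swap ⋙ swap ≅ 𝟭` (componentwise the identity). [cite: MochizukiFrdI2008, Ex. 3.9 p.72] -/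
def swapSwapIso : swap ⋙ swap ≅ 𝟭 C.category :=
  NatIso.ofComponents (fun X => Iso.refl X) fun {X Y} φ => by
    refine (Category.comp_id _).trans (Eq.trans ?_ (Category.id_comp _).symm)
    exact swapMap_swapMap φ

/-- **The swap is a self-equivalence of the category of `C`** ("hence a self-equivalence of `C`", p. 72).
[cite: MochizukiFrdI2008, Ex. 3.9 p.72] -/
def swapEquiv : C.category ≌ C.category :=
  CategoryTheory.Equivalence.mk swap swap swapSwapIso.symm swapSwapIso

/-- **Every typed hypothesis of Cor. 3.8 holds for `Ψ := swap : C ⥲ C`**: the base `SingleObj G` is of FSM-, hence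
FSMFF-type ("`D` is manifestly of FSM-, hence also of FSMFF-type", p. 72), and "non-dilating" reads `True` in the
trivial vocabulary. [cite: MochizukiEtTh2009, Cor 3.8 p.80] -/
def hyp : Cor38Hyp C C where
  Ψ := swapEquiv
  fsmff := ⟨isOfFSMFFType_D, isOfFSMFFType_D⟩
  nonDilating := ⟨fun _ _ => trivial, fun _ _ => trivial⟩

/-! ### §3  Row F-2812 at `hyp`, and its universal closure -/

/-- The Frobenius-trivial object `(•, 0)`. [cite: MochizukiFrdI2008, Thm. 5.2 (i) p.100] -/
abbrev X₀ : C.category := ⟨SingleObj.star G, 1⟩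

/-- `α₀ = (1, 1_G, (1, 0))`: the base-identity linear endomorphism of `(•, 0)` with zero divisor the unit `(1,0)` of
`V × W` (an element of `O^×((•,0)) ⊆ O^▷((•,0))`). [cite: MochizukiFrdI2008, Ex. 3.9 p.72] -/
def α₀ : (X₀ : C.category) ⟶ X₀ :=
  mkHom X₀ X₀ 1 (𝟙 _) ⟨Multiplicative.ofAdd ((1 : ℚ), (0 : ℕ)), trivial⟩

/-- `α₀ ∈ O^▷((•, 0))`: base-identity and linear. [cite: MochizukiFrdI2008, Def. 1.2 (ii) p.22] -/
theorem α₀_mem : (α₀ : End (X₀ : C.category)) ∈ C.opsData.endSubmonoid X₀ := ⟨rfl, rfl⟩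

/-- `swap α₀` has base `(1, 1) ≠ 1_G = (0, 1)`: it is NOT a base-identity endomorphism.
[cite: MochizukiFrdI2008, Ex. 3.9 p.72] -/
theorem swap_α₀_not_mem : (swap.map α₀ : End (X₀ : C.category)) ∉ C.opsData.endSubmonoid X₀ := by
  rintro ⟨h, -⟩
  have h' : gOf (swapMap α₀) = 1 := h
  have hu := congrArg G.u h'
  rw [gOf_swapMap, swapBase_u, G.one_u] at hu
  have h1 : gOf α₀ = 1 := rfl
  have h2 : zOf α₀ = ((1 : ℚ), (0 : ℕ)) := rfl
  rw [h1, h2, G.one_n, Positive.val_one, one_mul] at hu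
  exact one_ne_zero hu

/-- **Row F-2812 FAILS at `hyp`**: `Ψ = swap` does not carry `O^▷((•,0))` into `O^▷((•,0))` ("fails to preserve
… '`O^▷(−)`'", [FrdI] p. 72) although every typed hypothesis of Cor. 3.8 holds. [cite: MochizukiEtTh2009, Cor 3.8 p.81] -/
theorem not_preservesOTri : ¬ hyp.PreservesOTri :=
  fun h => swap_α₀_not_mem (h.1 X₀ α₀ α₀_mem)

/-- **F-2812 as typed is not a fact over ALL `Cor38Hyp` records:** the universal closure (universe level `0`) is
FALSE.  Instance forms: `Cor38Hyp.preservesOTri_treeCatVocab_of_isFrobeniusSlim` / `…_of_baseSquares` (abc-iut-f-001),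
`preservesOTri_of_thm34iv` / `preservesOTri_of_baseSquare` (sub-DAG). [cite: MochizukiEtTh2009, Cor 3.8 p.81] -/
theorem not_forall_preservesOTri :
    ¬ ∀ {D₀ : Type} [Category.{0} D₀] {V : FrdIMonoidStub.{0}} {T : RealifiedDivisorMonoids (D₀ := D₀) V}
        {D : Type} [Category.{0} D] {VD : FrdICatStub.{0, 0, 0} D}
        {D₀' : Type} [Category.{0} D₀'] {T' : RealifiedDivisorMonoids (D₀ := D₀') V}
        {D' : Type} [Category.{0} D'] {VD' : FrdICatStub.{0, 0, 0} D'}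
        {C₁ : TemperedFrobenioid T D VD} {C₂ : TemperedFrobenioid T' D' VD'} (h : Cor38Hyp C₁ C₂),
        h.PreservesOTri :=
  fun h => not_preservesOTri (h hyp)

/-- Row F-2815 HOLDS at `hyp`: the swap and its quasi-inverse fix Frobenius degrees — the datum does not bear on
the closure of `PreservesLinear`. [cite: MochizukiEtTh2009, Cor 3.8 p.81] -/
theorem preservesLinear_hyp : hyp.PreservesLinear :=
  ⟨fun _ _ _ h => h, fun _ _ _ h => h⟩

/-- Row F-2809 HOLDS at `hyp`: degrees are fixed and every arrow of the groupoid base is an isomorphism — the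
datum does not bear on the closure of `PreservesPreSteps`. [cite: MochizukiEtTh2009, Cor 3.8 p.81] -/
theorem preservesPreSteps_hyp : hyp.PreservesPreSteps :=
  ⟨fun _ _ _ h => ⟨h.1, IsIso.of_groupoid _⟩, fun _ _ _ h => ⟨h.1, IsIso.of_groupoid _⟩⟩

end OTriTwist

end Literature.AnabelianGeometry.EtaleTheta

end
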